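import Literature.AnabelianGeometry.SemiGraphs.TemperedGeodesicEdgesHostable
import HarnessLib

/-!
# [SemiAnbd] Thm 3.7 (iii) / Cor 3.9 (R3c) at graphs whose HOSTABLE edges form no core: the binder `hbdd`,
# (FIX∞).hadj and F-2772 `EdgeLikeCentralizerAt` (cores of non-hosting edges allowed)

Mochizuki, *Semi-graphs of anabelioids*, Publ. RIMS **42** (2006), §3, Theorem 3.7 (iii), manuscript p. 41, and
Corollary 3.9, proof p. 43 l. 13 ("[again by Theorem 3.7, (iii), (iv)]" — the step the cell names (R3c)
`EdgeLikeCentralizerAt` / `EdgeLikeCentralizer`, FACT-LIST rows F-2772 / F-2773)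
[cite: MochizukiSemiAnbd2006, Cor 3.9 p.43].

PROOF-ONLY (cell abc-iut, block F, seat abc-iut-f-176 gen 4; desk memo
`HOME/staging/f/f-176/g4/FINDING-core-bouquet.md` §2/§5; no definition, no named fact, no custody file touched).
`TemperedHbddOfNoCore.lean` proved hadj and (R3c) at graphs WITHOUT an infinitely-branching core.  Here the core
condition is imposed only on the edges that can HOST the compact subgroup: for `C ≤ π₁^temp(𝒢)` call a base edge `m`
`C`-HOSTABLE if some edge-like subgroup over `m` contains `C` (`∃ L ∈ edgeLikeSubgroups c m, C ≤ L`, stated inline).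

* `VerticialLevelData.dist_le_four_of_noCore_over` / `hbdd_of_noCore_over` (abstract level data, merged depth
  hypothesis `hLE`, a set `E` of base edges containing the base edge of every branch-point of every fixed geodesic):
  if every non-empty vertex set `S` has a member with finitely many branches `b` with `edgeOf b ∈ E` toward `S`, then
  `dist (x j, x' j) ≤ 4` — the argument of `dist_le_four_of_noCore` verbatim, the core being built from `E`-edges only;
* canonical tower: by `exists_edgeLike_ge_of_branch_mem_geodesic` (`TemperedGeodesicEdgesHostable.lean`) the set of
  `C`-hostable edges qualifies as `E`; hence `hadj_temperedPiChart_of_noHostableCore`,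
  `centralizer_le_verticial_of_noHostableCore` (every chart — the hypothesis is transported along the chart
  comparison, `mem_edgeLikeSubgroups_iff_map`), **`edgeLikeCentralizerAt_of_noHostableCore`** — (R3c) F-2772 at
  EVERY chart of every Cor-3.9 graph in which, for every open piece `ψ(U)` of an edge group, the `ψ(U)`-HOSTABLE edges
  form no core — and **`edgeLikeCentralizer_of_noHostableCore`** (F-2773 restricted ∀, hypothesis-free).

So a `¬∀` witness for F-2773 needs an infinitely-branching core OF HOSTABLE EDGES (impossible e.g. when the edge groups
off the host edge are pro-`ℓ'` for primes `ℓ'` foreign to `Π_e`).  Honest framing: statements about OUR typed tempered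
fundamental groups; the bare ∀-closure of F-2773 is NOT claimed; cone-irrelevant beyond finite dual graphs; no side
taken on [IUTchIII] Cor. 3.12; typed ≠ proved elsewhere.
-/

namespace Literature.AnabelianGeometry.SemiGraphs

namespace SemiGraph

universe u
variable (G : SemiGraph.{u})

/-- **Edges have two ends** (relative to a set `E` of edges): infinitely many branches at `w` with edge in `E` whose
other branch abuts `y` give infinitely many such branches at `y` toward `w` ("the other branch" is an injection
preserving the edge). [cite: MochizukiSemiAnbd2006, §1 p.11] -/
theorem infinite_toward_symm_of_mem (E : Set G.Edge) {w y : G.Vertex}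
    (h : {b : G.Branch | G.abuts b = some w ∧ G.edgeOf b ∈ E ∧ ∃ b', b' ≠ b ∧ G.edgeOf b' = G.edgeOf b ∧
      G.abuts b' = some y}.Infinite) :
    {b : G.Branch | G.abuts b = some y ∧ G.edgeOf b ∈ E ∧ ∃ b', b' ≠ b ∧ G.edgeOf b' = G.edgeOf b ∧
      G.abuts b' = some w}.Infinite := by
  classical
  have hoth : ∀ b : G.Branch, ∃ b' : G.Branch, b' ≠ b ∧ G.edgeOf b' = G.edgeOf b ∧
      ∀ d, G.edgeOf d = G.edgeOf b → d = b ∨ d = b' := by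
    intro b
    obtain ⟨b₁, b₂, hne, h₁, h₂, hall⟩ := G.two_branches (G.edgeOf b)
    rcases hall b rfl with rfl | rfl
    · exact ⟨b₂, hne.symm, h₂, fun d hd => hall d hd⟩
    · exact ⟨b₁, hne, h₁, fun d hd => (hall d hd).symm⟩
  choose oth hoth_ne hoth_e hoth_all using hoth
  refine Set.infinite_of_injOn_mapsTo (f := oth) ?_ ?_ h
  · intro b₁ _ b₂ _ heq
    rcases hoth_all b₁ b₂ (by rw [← hoth_e b₂, ← heq, hoth_e b₁]) with h | h
    · exact h.symm
    · exact absurd (heq.symm.trans h.symm) (hoth_ne b₂)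
  · rintro b ⟨hbw, hbE, b', hb'b, hb'e, hb'y⟩
    have hb' : b' = oth b := ((hoth_all b b' hb'e).resolve_left hb'b)
    subst hb'
    exact ⟨hb'y, by rw [hoth_e b]; exact hbE, b, (hoth_ne b).symm, (hoth_e b).symm, hbw⟩

end SemiGraph

/-! ### Over abstract level data: no core of `E`-edges ⇒ `dist ≤ 4` when all fixed geodesics travel over `E` -/

namespace ProfiniteSemiGraph

namespace VerticialLevelData

open CategoryTheory Topology

universe v u
variable {𝒢 : ProfiniteSemiGraph.{u}} {c : TemperedPiChart 𝒢} (D : VerticialLevelData.{v} 𝒢 c)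

/-- `proj_k (v) = proj_j (trans v)`. [cite: MochizukiSemiAnbd2006, Thm 3.7(iii) p.41] -/
private theorem proj_trans_vertexMap' ⦃j k : D.J⦄ (h : j ≤ k) (v : (D.tree k).Vertex) :
    (D.proj k).vertexMap v = (D.proj j).vertexMap ((D.trans h).vertexMap v) := by
  have e := congrArg (fun φ => SemiGraph.Hom.vertexMap φ v) (D.trans_over h)
  simpa only [SemiGraph.comp_vertexMap, Function.comp_apply] using e.symm

/-- The base vertex of a compatible system is level-independent. [cite: MochizukiSemiAnbd2006, Thm 3.7(iii) p.41] -/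
private theorem proj_vertexMap_eq_of_compat (x : ∀ j, (D.tree j).Vertex)
    (hx : ∀ ⦃i j : D.J⦄ (h : i ≤ j), (D.trans h).vertexMap (x j) = x i) (j k : D.J) :
    (D.proj k).vertexMap (x k) = (D.proj j).vertexMap (x j) := by
  obtain ⟨m, hjm, hkm⟩ := exists_ge_ge j k
  rw [← hx hjm, ← hx hkm, ← D.proj_trans_vertexMap' hjm, ← D.proj_trans_vertexMap' hkm]

/-- On a `C`-fixed walk the edge of a branch-point is `C`-fixed. [cite: MochizukiSemiAnbd2006, Thm 3.7(iii) p.41] -/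
private theorem edgeMap_eq_of_fixed_support' (C : Subgroup c.G) {K : D.J} {z z' : (D.tree K).Node}
    {p : (D.tree K).subdivision.Walk z z'}
    (hfix : ∀ z ∈ p.support, ∀ g ∈ C, SemiGraph.nodeMap (D.act K g) z = z)
    (β : (D.tree K).Branch) (hβ : (Sum.inr (Sum.inr β) : (D.tree K).Node) ∈ p.support) :
    ∀ g ∈ C, (D.act K g).hom.edgeMap ((D.tree K).edgeOf β) = (D.tree K).edgeOf β := by
  intro g hg
  have h := hfix _ hβ g hg
  simp only [SemiGraph.nodeMap_inr_inr, Sum.inr.injEq] at h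
  rw [← (D.act K g).hom.edgeOf_branchMap β, h]

/-- **No core of `E`-edges ⇒ `dist ≤ 4`, when every fixed geodesic travels over `E`** ([SemiAnbd] Thm 3.7 (iii),
second sentence).  With `D`, `C`, `hLE`, `x`, `x'` as in `dist_le_four_of_noCore`, let `E` be a set of base edges
containing the base edge of every branch-point of every path `[x K, x' K]` (`hE`); if every non-empty set `S` of base
vertices has a member with only finitely many branches `b`, `edgeOf b ∈ E`, whose edge has another branch abutting
`S` (`hNC`), then `x j`, `x' j` are equal or the two ends of one edge at every level.
[cite: MochizukiSemiAnbd2006, Thm 3.7(iii) p.41] -/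
theorem dist_le_four_of_noCore_over (C : Subgroup c.G)
    (hLE : ∀ (w : 𝒢.graph.Vertex) (B : Set 𝒢.graph.Branch), B.Finite →
      (∀ b ∈ B, 𝒢.graph.abuts b = some w) → ∀ j : D.J, ∃ (k : D.J) (hjk : j ≤ k),
      ∀ (v : (D.tree k).Vertex), (D.proj k).vertexMap v = w →
      ∀ (β₁ β₂ : (D.tree k).Branch), (D.tree k).abuts β₁ = some v → (D.tree k).abuts β₂ = some v →
      (D.proj k).branchMap β₁ ∈ B → (D.proj k).branchMap β₂ ∈ B →
      (∀ g ∈ C, (D.act k g).hom.edgeMap ((D.tree k).edgeOf β₁) = (D.tree k).edgeOf β₁) →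
      (∀ g ∈ C, (D.act k g).hom.edgeMap ((D.tree k).edgeOf β₂) = (D.tree k).edgeOf β₂) →
      (D.trans hjk).branchMap β₁ = (D.trans hjk).branchMap β₂)
    (E : Set 𝒢.graph.Edge)
    (hNC : ∀ S : Set 𝒢.graph.Vertex, S.Nonempty → ∃ w ∈ S,
      {b : 𝒢.graph.Branch | 𝒢.graph.abuts b = some w ∧ 𝒢.graph.edgeOf b ∈ E ∧ ∃ b', b' ≠ b ∧
        𝒢.graph.edgeOf b' = 𝒢.graph.edgeOf b ∧ ∃ w' ∈ S, 𝒢.graph.abuts b' = some w'}.Finite)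
    (x x' : ∀ j, (D.tree j).Vertex)
    (hx : ∀ ⦃i j : D.J⦄ (h : i ≤ j), (D.trans h).vertexMap (x j) = x i)
    (hx' : ∀ ⦃i j : D.J⦄ (h : i ≤ j), (D.trans h).vertexMap (x' j) = x' i)
    (hfx : ∀ g ∈ C, ∀ j, (D.act j g).hom.vertexMap (x j) = x j)
    (hfx' : ∀ g ∈ C, ∀ j, (D.act j g).hom.vertexMap (x' j) = x' j)
    (hE : ∀ (K : D.J) (p : (D.tree K).subdivision.Walk (Sum.inl (x K)) (Sum.inl (x' K))), p.IsPath →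
      ∀ β : (D.tree K).Branch, (Sum.inr (Sum.inr β) : (D.tree K).Node) ∈ p.support →
        (D.proj K).edgeMap ((D.tree K).edgeOf β) ∈ E)
    (j : D.J) : (D.tree j).subdivision.dist (Sum.inl (x j)) (Sum.inl (x' j)) ≤ 4 := by
  classical
  by_contra hfar
  obtain ⟨u, hu, hu', hsep⟩ := SemiGraph.exists_separating_of_four_lt_dist (D.isTree j).isTree hfar
  -- base points of the two systems (level-independent)
  set a := (D.proj j).vertexMap (x j) with ha
  set a' := (D.proj j).vertexMap (x' j) with ha'
  have hxa : ∀ k, (D.proj k).vertexMap (x k) = a := fun k => D.proj_vertexMap_eq_of_compat x hx j k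
  have hxa' : ∀ k, (D.proj k).vertexMap (x' k) = a' := fun k => D.proj_vertexMap_eq_of_compat x' hx' j k
  -- the base vertices under separating vertices, at all levels
  let W : Set 𝒢.graph.Vertex := {w | ∃ (k : D.J) (v : (D.tree k).Vertex), v ≠ x k ∧ v ≠ x' k ∧
    (∀ q : (D.tree k).subdivision.Walk (Sum.inl (x k)) (Sum.inl (x' k)),
      (Sum.inl v : (D.tree k).Node) ∈ q.support) ∧ (D.proj k).vertexMap v = w}
  -- `E`-branches at `w` whose edge has another branch abutting a vertex satisfying `P`
  let T : 𝒢.graph.Vertex → (𝒢.graph.Vertex → Prop) → Set 𝒢.graph.Branch := fun w P =>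
    {b | 𝒢.graph.abuts b = some w ∧ 𝒢.graph.edgeOf b ∈ E ∧ ∃ b', b' ≠ b ∧ 𝒢.graph.edgeOf b' = 𝒢.graph.edgeOf b ∧
      ∃ w', 𝒢.graph.abuts b' = some w' ∧ P w'}
  -- CLAIM 1: every `w ∈ W` has infinitely many `E`-branches toward `W ∪ {a, a'}`
  have hW : ∀ w ∈ W, (T w fun w' => w' ∈ W ∨ w' = a ∨ w' = a').Infinite := by
    rintro w ⟨k, u₀, hu₀, hu₀', hsep₀, rfl⟩ hBfin
    obtain ⟨K, hkK, hK⟩ := hLE _ _ hBfin (fun b hb => hb.1) k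
    obtain ⟨p, hpp, hfix, i, ũ, β₁, β₂, hi, hi₁, hũ, hi₂, hβ₁, hβ₂, hũu, hne⟩ :=
      D.exists_fixed_turn C x x' hx hx' hfx hfx' hkK u₀ hu₀ hu₀' hsep₀
    have hTK := (D.isTree K).isTree
    have hũw : (D.proj K).vertexMap ũ = (D.proj k).vertexMap u₀ := by
      rw [D.proj_trans_vertexMap' hkK, hũu]
    -- not both base branches of the turn are `E`-branches toward `W ∪ {a, a'}`
    have hout : (D.proj K).branchMap β₁ ∉ T ((D.proj k).vertexMap u₀) (fun w' => w' ∈ W ∨ w' = a ∨ w' = a') ∨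
        (D.proj K).branchMap β₂ ∉ T ((D.proj k).vertexMap u₀) (fun w' => w' ∈ W ∨ w' = a ∨ w' = a') := by
      by_contra h
      rw [not_or, not_not, not_not] at h
      exact hne (hK ũ hũw β₁ β₂ hβ₁ hβ₂ h.1 h.2
        (D.edgeMap_eq_of_fixed_support' C hfix β₁ (hi₁ ▸ p.getVert_mem_support i))
        (D.edgeMap_eq_of_fixed_support' C hfix β₂ (hi₂ ▸ p.getVert_mem_support (i + 2))))
    -- every vertex of the geodesic lies over `W`, over `a`, or over `a'`
    have hvert : ∀ (n : ℕ) (v : (D.tree K).Vertex), n ≤ p.length → p.getVert n = Sum.inl v →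
        (D.proj K).vertexMap v ∈ W ∨ (D.proj K).vertexMap v = a ∨ (D.proj K).vertexMap v = a' := by
      intro n v hn hv
      by_cases h0 : n = 0
      · subst h0
        rw [SimpleGraph.Walk.getVert_zero] at hv
        exact Or.inr (Or.inl (by rw [← Sum.inl_injective hv, hxa K]))
      by_cases hl : n = p.length
      · subst hl
        rw [SimpleGraph.Walk.getVert_length] at hv
        exact Or.inr (Or.inr (by rw [← Sum.inl_injective hv, hxa' K]))
      refine Or.inl ⟨K, v, ?_, ?_, fun q => SemiGraph.mem_support_of_mem_support_path hTK.isAcyclic p hpp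
        (hv ▸ p.getVert_mem_support n) q, rfl⟩
      · rintro rfl
        refine h0 (hpp.getVert_injOn (by rw [Set.mem_setOf_eq]; omega) (by rw [Set.mem_setOf_eq]; omega) ?_)
        rw [hv, SimpleGraph.Walk.getVert_zero]
      · rintro rfl
        refine hl (hpp.getVert_injOn (by rw [Set.mem_setOf_eq]; omega) (by rw [Set.mem_setOf_eq]) ?_)
        rw [hv, SimpleGraph.Walk.getVert_length]
    -- the edges of both branch-points lie over `E`
    have hE₁ : 𝒢.graph.edgeOf ((D.proj K).branchMap β₁) ∈ E := by
      rw [(D.proj K).edgeOf_branchMap]; exact hE K p hpp β₁ (hi₁ ▸ p.getVert_mem_support i)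
    have hE₂ : 𝒢.graph.edgeOf ((D.proj K).branchMap β₂) ∈ E := by
      rw [(D.proj K).edgeOf_branchMap]; exact hE K p hpp β₂ (hi₂ ▸ p.getVert_mem_support (i + 2))
    rcases hout with h₁ | h₂
    · -- backwards along the geodesic: `β₁`'s edge leads to `p_{i-3}`
      obtain ⟨β₁', v', hβ₁'ne, hβ₁'e, hβ₁'v, h3i, hv'⟩ :=
        SemiGraph.exists_getVert_sub_three hpp (by omega) hũ hi₁
      exact h₁ ⟨by rw [(D.proj K).abuts_branchMap β₁ ũ hβ₁, hũw], hE₁, (D.proj K).branchMap β₁',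
        fun h => hβ₁'ne ((D.proj K).branchMap_injOn _ _ hβ₁'e h),
        by rw [(D.proj K).edgeOf_branchMap, (D.proj K).edgeOf_branchMap, hβ₁'e],
        (D.proj K).vertexMap v', (D.proj K).abuts_branchMap β₁' v' hβ₁'v, hvert (i - 3) v' (by omega) hv'⟩
    · -- forwards along the geodesic: `β₂`'s edge leads to `p_{i+5}`
      obtain ⟨β₂', v', hβ₂'ne, hβ₂'e, hβ₂'v, hi5, hv'⟩ :=
        SemiGraph.exists_getVert_add_five hpp hi hũ hi₂
      exact h₂ ⟨by rw [(D.proj K).abuts_branchMap β₂ ũ hβ₂, hũw], hE₂, (D.proj K).branchMap β₂',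
        fun h => hβ₂'ne ((D.proj K).branchMap_injOn _ _ hβ₂'e h),
        by rw [(D.proj K).edgeOf_branchMap, (D.proj K).edgeOf_branchMap, hβ₂'e],
        (D.proj K).vertexMap v', (D.proj K).abuts_branchMap β₂' v' hβ₂'v, hvert (i + 5) v' hi5 hv'⟩
  -- CLAIM 2: `W`, enlarged by the ends `a`, `a'` receiving infinitely many `E`-edges from `W`, is a core
  let S : Set 𝒢.graph.Vertex := W ∪ {y | (y = a ∨ y = a') ∧ (T y fun w' => w' ∈ W).Infinite}
  have hWS : W ⊆ S := Set.subset_union_left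
  have hSne : S.Nonempty := ⟨(D.proj j).vertexMap u, hWS ⟨j, u, hu, hu', hsep, rfl⟩⟩
  obtain ⟨w, hwS, hwfin⟩ := hNC S hSne
  have hmono : ∀ X : Set 𝒢.graph.Vertex, X ⊆ S → (T w fun w' => w' ∈ X).Finite := by
    intro X hX
    refine hwfin.subset ?_
    rintro b ⟨hb, hbE, b', hb'b, hb'e, w', hb'w, hw'⟩
    exact ⟨hb, hbE, b', hb'b, hb'e, w', hX hw', hb'w⟩
  rcases hwS with hwW | ⟨hwa, hwinf⟩
  · -- `w ∈ W`: an end receiving infinitely many `E`-edges from `w` would be in `S` — so all three parts are finite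
    have hend : ∀ y : 𝒢.graph.Vertex, (y = a ∨ y = a') →
        ¬ {b : 𝒢.graph.Branch | 𝒢.graph.abuts b = some w ∧ 𝒢.graph.edgeOf b ∈ E ∧ ∃ b', b' ≠ b ∧
          𝒢.graph.edgeOf b' = 𝒢.graph.edgeOf b ∧ 𝒢.graph.abuts b' = some y}.Infinite := by
      intro y hy hinf
      have hyS : y ∈ S := by
        refine Or.inr ⟨hy, (𝒢.graph.infinite_toward_symm_of_mem E hinf).mono ?_⟩
        rintro b ⟨hb, hbE, b', hb'b, hb'e, hb'w⟩
        exact ⟨hb, hbE, b', hb'b, hb'e, w, hb'w, hwW⟩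
      refine hinf ((hmono {y} (Set.singleton_subset_iff.2 hyS)).subset ?_)
      rintro b ⟨hb, hbE, b', hb'b, hb'e, hb'y⟩
      exact ⟨hb, hbE, b', hb'b, hb'e, y, hb'y, rfl⟩
    refine hW w hwW (((hmono W hWS).union ((Set.not_infinite.1 (hend a (Or.inl rfl))).union
      (Set.not_infinite.1 (hend a' (Or.inr rfl))))).subset ?_)
    rintro b ⟨hb, hbE, b', hb'b, hb'e, w', hb'w, hw' | rfl | rfl⟩
    · exact Or.inl ⟨hb, hbE, b', hb'b, hb'e, w', hb'w, hw'⟩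
    · exact Or.inr (Or.inl ⟨hb, hbE, b', hb'b, hb'e, hb'w⟩)
    · exact Or.inr (Or.inr ⟨hb, hbE, b', hb'b, hb'e, hb'w⟩)
  · -- `w = a` or `w = a'` receiving infinitely many `E`-edges from `W ⊆ S`: absurd
    exact hwinf (hmono W hWS)

end VerticialLevelData

/-! ### The canonical tower: (FIX∞).hadj, centralisers and (R3c) when the hostable edges form no core -/

section Canonical

open CategoryTheory Topology

universe u
variable (𝒢 : ProfiniteSemiGraph.{u}) {ℋ : ProfiniteSemiGraph.{u}}

/-- **(FIX∞).hadj at the canonical tower when the `C`-hostable edges form no core**: for `𝒢` satisfying the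
hypotheses of Thm 3.7, a compact `C ≠ 1`, and two compatible `C`-fixed vertex systems: if every non-empty vertex set
`S` has a member with only finitely many branches `b`, whose edge carries an edge-like subgroup containing `C`, toward
`S` (`hNC`), then at every level where they differ the two systems are the ends of a `C`-fixed edge
(`dist_le_four_of_noCore_over` with `E :=` the hostable edges, qualified by `exists_edgeLike_ge_of_branch_mem_geodesic`;
then abc-iut-L3-t10's `hadj_temperedPiChart_of_bounded_dist'`). [cite: MochizukiSemiAnbd2006, Thm 3.7(iii) p.41] -/
theorem hadj_temperedPiChart_of_noHostableCore (h37 : 𝒢.Thm37Hypotheses)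
    (C : Subgroup (𝒢.temperedPiChart h37.toProp36Hypotheses).G)
    (hCc : IsCompact (C : Set (𝒢.temperedPiChart h37.toProp36Hypotheses).G)) (hC : C ≠ ⊥)
    (hNC : ∀ S : Set 𝒢.graph.Vertex, S.Nonempty → ∃ w ∈ S,
      {b : 𝒢.graph.Branch | 𝒢.graph.abuts b = some w ∧
        (∃ L ∈ edgeLikeSubgroups (𝒢.temperedPiChart h37.toProp36Hypotheses) (𝒢.graph.edgeOf b), C ≤ L) ∧
        ∃ b', b' ≠ b ∧ 𝒢.graph.edgeOf b' = 𝒢.graph.edgeOf b ∧ ∃ w' ∈ S, 𝒢.graph.abuts b' = some w'}.Finite)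
    (x x' : ∀ j, ((verticialLevelData_temperedPiChart (h36 := h37.toProp36Hypotheses)).tree j).Vertex)
    (hx : ∀ ⦃i j : ℕ⦄ (hij : i ≤ j), ((verticialLevelData_temperedPiChart (h36 := h37.toProp36Hypotheses)).trans hij).vertexMap (x j) = x i)
    (hx' : ∀ ⦃i j : ℕ⦄ (hij : i ≤ j), ((verticialLevelData_temperedPiChart (h36 := h37.toProp36Hypotheses)).trans hij).vertexMap (x' j) = x' i)
    (hfx : ∀ g ∈ C, ∀ j, ((verticialLevelData_temperedPiChart (h36 := h37.toProp36Hypotheses)).act j g).hom.vertexMap (x j) = x j)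
    (hfx' : ∀ g ∈ C, ∀ j, ((verticialLevelData_temperedPiChart (h36 := h37.toProp36Hypotheses)).act j g).hom.vertexMap (x' j) = x' j)
    (j : ℕ) (hne : x j ≠ x' j) :
    ∃ (e : ((verticialLevelData_temperedPiChart (h36 := h37.toProp36Hypotheses)).tree j).Edge)
      (b b' : ((verticialLevelData_temperedPiChart (h36 := h37.toProp36Hypotheses)).tree j).Branch), b ≠ b' ∧
      ((verticialLevelData_temperedPiChart (h36 := h37.toProp36Hypotheses)).tree j).edgeOf b = e ∧
      ((verticialLevelData_temperedPiChart (h36 := h37.toProp36Hypotheses)).tree j).edgeOf b' = e ∧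
      ((verticialLevelData_temperedPiChart (h36 := h37.toProp36Hypotheses)).tree j).abuts b = some (x j) ∧
      ((verticialLevelData_temperedPiChart (h36 := h37.toProp36Hypotheses)).tree j).abuts b' = some (x' j) ∧
      ∀ g ∈ C, ((verticialLevelData_temperedPiChart (h36 := h37.toProp36Hypotheses)).act j g).hom.edgeMap e = e :=
  hadj_temperedPiChart_of_bounded_dist' h37 C hCc hC x x' hx hx' hfx hfx'
    ⟨4, (verticialLevelData_temperedPiChart (h36 := h37.toProp36Hypotheses)).dist_le_four_of_noCore_over C
      (fun w B hB hBw j => 𝒢.leFinset_temperedPiChart h37 C hC w B hB hBw j)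
      {m | ∃ L ∈ edgeLikeSubgroups (𝒢.temperedPiChart h37.toProp36Hypotheses) m, C ≤ L} hNC x x' hx hx' hfx hfx'
      (fun K p hp β hβ => 𝒢.exists_edgeLike_ge_of_branch_mem_geodesic h37.toProp36Hypotheses C x x' hx hx' hfx
        hfx' K p hp β hβ)⟩ j hne

/-- **The centraliser of a nontrivial compact `C` lies in each verticial host of `C`, at EVERY chart, whenever the
`C`-hostable edges form no core** (abc-iut-f-172's `centralizer_le_of_hadj` at the transported level data; the
hypothesis is carried to the canonical chart along the chart comparison `φ`, `ψ`: an edge-like subgroup `L₀ ⊇ ψ(C)`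
there gives the edge-like subgroup `φ(L₀) ⊇ C` here, `mem_edgeLikeSubgroups_iff_map`).
[cite: MochizukiSemiAnbd2006, Thm 3.7(iii) pp.40-41] -/
theorem centralizer_le_verticial_of_noHostableCore (h37 : 𝒢.Thm37Hypotheses) (c : TemperedPiChart 𝒢)
    (C : Subgroup c.G) (hCc : IsCompact (C : Set c.G)) (hC : C ≠ ⊥)
    (hNC : ∀ S : Set 𝒢.graph.Vertex, S.Nonempty → ∃ w ∈ S,
      {b : 𝒢.graph.Branch | 𝒢.graph.abuts b = some w ∧ (∃ L ∈ edgeLikeSubgroups c (𝒢.graph.edgeOf b), C ≤ L) ∧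
        ∃ b', b' ≠ b ∧ 𝒢.graph.edgeOf b' = 𝒢.graph.edgeOf b ∧ ∃ w' ∈ S, 𝒢.graph.abuts b' = some w'}.Finite)
    {v : 𝒢.graph.Vertex} {H : Subgroup c.G} (hH : H ∈ verticialSubgroups c v) (hCH : C ≤ H) :
    Subgroup.centralizer (C : Set c.G) ≤ H := by
  obtain ⟨φ, ψ, hψφ, hφψ, hφ, hψ⟩ :=
    TemperedPiChart.exists_compatIso (𝒢.temperedPiChart h37.toProp36Hypotheses) c
  let D₀ := verticialLevelData_temperedPiChart (h36 := h37.toProp36Hypotheses)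
  let D : VerticialLevelData.{0} 𝒢 c := D₀.transport φ ψ hψφ hφψ
    (fun v H => mem_verticialSubgroups_iff_map φ hφ ψ hφψ hψ H)
    (fun e L => mem_edgeLikeSubgroups_iff_map φ hφ ψ hφψ hψ L)
  -- the hypothesis at the canonical chart, for `ψ(C)`
  have hNC₀ : ∀ S : Set 𝒢.graph.Vertex, S.Nonempty → ∃ w ∈ S,
      {b : 𝒢.graph.Branch | 𝒢.graph.abuts b = some w ∧
        (∃ L ∈ edgeLikeSubgroups (𝒢.temperedPiChart h37.toProp36Hypotheses) (𝒢.graph.edgeOf b),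
          C.map ψ.toMonoidHom ≤ L) ∧
        ∃ b', b' ≠ b ∧ 𝒢.graph.edgeOf b' = 𝒢.graph.edgeOf b ∧ ∃ w' ∈ S, 𝒢.graph.abuts b' = some w'}.Finite := by
    intro S hS
    obtain ⟨w, hw, hfin⟩ := hNC S hS
    refine ⟨w, hw, hfin.subset ?_⟩
    rintro b ⟨hb, ⟨L₀, hL₀, hCL₀⟩, hrest⟩
    refine ⟨hb, ⟨L₀.map φ.toMonoidHom, (mem_edgeLikeSubgroups_iff_map ψ hψ φ hψφ hφ L₀).1 hL₀, ?_⟩, hrest⟩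
    intro g hg
    exact ⟨ψ g, hCL₀ ⟨g, hg, rfl⟩, hφψ g⟩
  refine D.centralizer_le_of_hadj verticialDistinct_holds h37 C ?_ hH hCH
  -- hadj for `C` at the transported level data, from hadj for `ψ(C)` at the canonical tower
  intro y y' hy hy' hfy hfy' j hj
  have hinj : Function.Injective ψ := fun y₁ y₂ h => by rw [← hφψ y₁, ← hφψ y₂, h]
  have hne' : C.map ψ.toMonoidHom ≠ ⊥ := fun h0 => hC ((Subgroup.map_eq_bot_iff_of_injective C hinj).mp h0)
  have hc : IsCompact ((C.map ψ.toMonoidHom : Subgroup (𝒢.temperedPiChart h37.toProp36Hypotheses).G) :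
      Set (𝒢.temperedPiChart h37.toProp36Hypotheses).G) := by
    rw [Subgroup.coe_map]
    exact hCc.image ψ.continuous
  have hfyψ : ∀ g ∈ C.map ψ.toMonoidHom, ∀ j, (D₀.act j g).hom.vertexMap (y j) = y j := by
    rintro _ ⟨g, hg, rfl⟩ j
    exact hfy g hg j
  have hfyψ' : ∀ g ∈ C.map ψ.toMonoidHom, ∀ j, (D₀.act j g).hom.vertexMap (y' j) = y' j := by
    rintro _ ⟨g, hg, rfl⟩ j
    exact hfy' g hg j
  obtain ⟨e, b, b', hbb, hbe, hb'e, hb, hb', hef⟩ :=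
    𝒢.hadj_temperedPiChart_of_noHostableCore h37 (C.map ψ.toMonoidHom) hc hne' hNC₀ y y' hy hy' hfyψ hfyψ' j hj
  exact ⟨e, b, b', hbb, hbe, hb'e, hb, hb', fun g hg => hef (ψ g) ⟨g, hg, rfl⟩⟩

/-- **(R3c) F-2772 `EdgeLikeCentralizerAt ℋ c` at EVERY chart of every Cor-3.9 graph of anabelioids in which, for
every open piece `ψ(U)` of an edge group, the `ψ(U)`-HOSTABLE edges form no core** (p. 43 l. 13 "[again by Theorem
3.7, (iii), (iv)]"): the centraliser of `ψ(U)` lies in every verticial subgroup containing it.  Cores made of edges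
that cannot carry an edge-like subgroup containing `ψ(U)` are allowed. [cite: MochizukiSemiAnbd2006, Cor 3.9 p.43] -/
theorem edgeLikeCentralizerAt_of_noHostableCore (hℋ : Cor39Hypotheses ℋ) (c : TemperedPiChart ℋ)
    (hNC : ∀ (e : ℋ.graph.Edge) (ψ : ℋ.Ge e →ₜ* c.G), IsEdgeHom c e ψ →
      ∀ (U : Subgroup (ℋ.Ge e)), IsOpen (U : Set (ℋ.Ge e)) →
      ∀ S : Set ℋ.graph.Vertex, S.Nonempty → ∃ w ∈ S,
        {b : ℋ.graph.Branch | ℋ.graph.abuts b = some w ∧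
          (∃ L ∈ edgeLikeSubgroups c (ℋ.graph.edgeOf b), U.map ψ.toMonoidHom ≤ L) ∧
          ∃ b', b' ≠ b ∧ ℋ.graph.edgeOf b' = ℋ.graph.edgeOf b ∧ ∃ w' ∈ S, ℋ.graph.abuts b' = some w'}.Finite) :
    EdgeLikeCentralizerAt ℋ c := by
  intro e ψ hψ U hU v H hH hUH
  obtain ⟨hCc, hC⟩ := isCompact_map_and_ne_bot_of_isEdgeHom hℋ c e ψ hψ U hU
  exact ℋ.centralizer_le_verticial_of_noHostableCore hℋ.thm37Hypotheses c _ hCc hC (hNC e ψ hψ U hU) hH hUH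

/-- **F-2773 `EdgeLikeCentralizer` RESTRICTED to graphs whose hostable edges form no core, hypothesis-free**: for
every graph of anabelioids satisfying the hypotheses of [SemiAnbd] Cor. 3.9 and every chart, if for every open piece
`ψ(U)` of an edge group the `ψ(U)`-hostable edges form no core, then `EdgeLikeCentralizerAt`.  (The bare ∀-countable
fact F-2773 additionally ranges over graphs with a core of hostable edges, not treated here.)
[cite: MochizukiSemiAnbd2006, Cor 3.9 p.43] -/
theorem edgeLikeCentralizer_of_noHostableCore :
    ∀ (ℋ : ProfiniteSemiGraph.{u}), Cor39Hypotheses ℋ → ∀ (c : TemperedPiChart ℋ),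
      (∀ (e : ℋ.graph.Edge) (ψ : ℋ.Ge e →ₜ* c.G), IsEdgeHom c e ψ →
        ∀ (U : Subgroup (ℋ.Ge e)), IsOpen (U : Set (ℋ.Ge e)) →
        ∀ S : Set ℋ.graph.Vertex, S.Nonempty → ∃ w ∈ S,
          {b : ℋ.graph.Branch | ℋ.graph.abuts b = some w ∧
            (∃ L ∈ edgeLikeSubgroups c (ℋ.graph.edgeOf b), U.map ψ.toMonoidHom ≤ L) ∧
            ∃ b', b' ≠ b ∧ ℋ.graph.edgeOf b' = ℋ.graph.edgeOf b ∧ ∃ w' ∈ S, ℋ.graph.abuts b' = some w'}.Finite) →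
      EdgeLikeCentralizerAt ℋ c :=
  fun _ hℋ c hNC => edgeLikeCentralizerAt_of_noHostableCore hℋ c hNC

/-- **NoCore ⇒ no core of hostable edges** (so this file STRICTLY generalises `TemperedHbddOfNoCore.lean`, whose
hypothesis is the case "every edge hostable"): if every non-empty vertex set has a member with finitely many branches
toward the set, then a fortiori one with finitely many `C`-hostable branches toward the set, for every chart `c` and
every `C`. [cite: MochizukiSemiAnbd2006, Cor 3.9 p.43] -/
theorem noHostableCore_of_noCore (c : TemperedPiChart ℋ) (C : Subgroup c.G)
    (hNC : ∀ S : Set ℋ.graph.Vertex, S.Nonempty → ∃ w ∈ S,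
      {b : ℋ.graph.Branch | ℋ.graph.abuts b = some w ∧ ∃ b', b' ≠ b ∧ ℋ.graph.edgeOf b' = ℋ.graph.edgeOf b ∧
        ∃ w' ∈ S, ℋ.graph.abuts b' = some w'}.Finite) :
    ∀ S : Set ℋ.graph.Vertex, S.Nonempty → ∃ w ∈ S,
      {b : ℋ.graph.Branch | ℋ.graph.abuts b = some w ∧ (∃ L ∈ edgeLikeSubgroups c (ℋ.graph.edgeOf b), C ≤ L) ∧
        ∃ b', b' ≠ b ∧ ℋ.graph.edgeOf b' = ℋ.graph.edgeOf b ∧ ∃ w' ∈ S, ℋ.graph.abuts b' = some w'}.Finite := by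
  intro S hS
  obtain ⟨w, hw, hfin⟩ := hNC S hS
  exact ⟨w, hw, hfin.subset fun b hb => ⟨hb.1, hb.2.2⟩⟩

end Canonical

end ProfiniteSemiGraph

end Literature.AnabelianGeometry.SemiGraphs
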